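import Summits.CriticalPhenomena.PercolationContinuityZ3.Theorems.PercNearOneGluingNoHeavyLowerTailQuantitativeHarrisProductWeightSections
import HarnessLib

/-!
# The equality family of the sharp Harris floors: `Cov(AND_A, OR_B) = Π_{i∈A} q_i · Π_{i∈B} (1 − q_i)` whenever `A ∩ B ≠ ∅`

Support file (`--supports stmt-CriticalPhenomena-4575`), prover seat `prim-rate-mine-2` (lane prim-rate, constants-miner (c), BENCH rows
M2-R48 / M2-R49; `run/shared/lean/prim/prim-rate/prim-rate-mine-2/PROOFS.md` §P49 (b)).  No definitions, no named facts, no sorries; standard axioms.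

`QuantHarris.cov_and_or_eq_prod` (row M2-R48) computed the covariance of `AND = 1{all open}` and `OR = 1{some open}` on the whole cube.
THIS FILE does it for arbitrary index sets: for finite `A, B` with a common coordinate,
* `QuantHarris.ex_andOn_eq_prod` — `E[1{x_i = 1 ∀ i ∈ A}] = Π_{i∈A} q_i`;
* `QuantHarris.ex_norOn_eq_prod` — `E[1{x_i = 0 ∀ i ∈ B}] = Π_{i∈B} (1 − q_i)` (bit-flip, `prodWeight_compl_not`);
* **`QuantHarris.cov_andOn_orOn_eq_prod`** — `E(AND_A · OR_B) − E(AND_A)·E(OR_B) = Π_{i∈A} q_i · Π_{i∈B} (1 − q_i)` (`AND_A ≤ OR_B` as `A ∩ B ≠ ∅`).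
For `e ∈ A ∩ B` the right side regroups as `q_e(1−q_e) · Π_{A∖B} q · Π_{B∖A} (1−q) · Π_{(A∩B)∖e} q(1−q)` — exactly the TWO-CYLINDER floor of row
M2-R49 (`QuantHarris.cov_ge_twoCyl`) with the cylinder witnesses `R₁ = A ∖ e` (pattern: open) for `AND_A` and `R₂ = B ∖ e` (pattern: closed) for
`OR_B`: every pair `(AND_A, OR_B)` sharing a coordinate is an EQUALITY case of the two-cylinder floor (and, when `A ∪ B` is everything, of the
two-atom floor of row M2-R48).  [cite: Harris1960, Lemma 4.1 (p. 16)] [cite: FortuinKasteleynGinibre1971, Prop. 1 (p. 91)]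
-/

noncomputable section

namespace Summit.CriticalPhenomena.PercolationContinuityZ3.Theorems

namespace QuantHarris

open Finset Literature.Combinatorics.Sahi2008 SahiSubsetChord SahiCoSingleton

variable {ι : Type*} [Fintype ι] [DecidableEq ι]

/-- `E[1{x_i = 1 for all i ∈ A}] = Π_{i∈A} q_i` under the product weight. [folklore] -/
theorem ex_andOn_eq_prod (q : ι → ℝ) (A : Finset ι) :
    ex (prodWeight q) (fun x => if (∀ i ∈ A, x i = true) then (1 : ℝ) else 0) = ∏ i ∈ A, q i := by
  have h := sum_coinWeight_forall q A
  unfold ex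
  rw [← h]
  refine Finset.sum_congr rfl fun x _ => ?_
  rw [mul_ite, mul_one, mul_zero]
  rfl

/-- `E[1{x_i = 0 for all i ∈ B}] = Π_{i∈B} (1 − q_i)` under the product weight. [folklore] -/
theorem ex_norOn_eq_prod (q : ι → ℝ) (B : Finset ι) :
    ex (prodWeight q) (fun x => if (∀ i ∈ B, x i = false) then (1 : ℝ) else 0) = ∏ i ∈ B, (1 - q i) := by
  have h := sum_coinWeight_forall (fun i => 1 - q i) B
  unfold ex
  rw [← h]
  refine Fintype.sum_bijective (fun x : ι → Bool => fun i => !x i)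
    (Function.Involutive.bijective fun x => funext fun i => by simp) _ _ fun x => ?_
  show prodWeight q x * (if (∀ i ∈ B, x i = false) then (1 : ℝ) else 0)
    = if (∀ i ∈ B, (!x i) = true) then coinWeight (fun i => 1 - q i) (fun i => !x i) else 0
  by_cases hx : ∀ i ∈ B, x i = false
  · have hx' : ∀ i ∈ B, (!x i) = true := fun i hi => by rw [hx i hi]; rfl
    rw [if_pos hx, if_pos hx', mul_one]
    exact (prodWeight_compl_not q x).symm
  · have hx' : ¬ ∀ i ∈ B, (!x i) = true := fun h' => hx fun i hi => by
      have := h' i hi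
      cases hxi : x i
      · rfl
      · rw [hxi] at this; exact absurd this Bool.false_ne_true
    rw [if_neg hx, if_neg hx', mul_zero]

/-- **`Cov(AND_A, OR_B) = Π_{i∈A} q_i · Π_{i∈B} (1 − q_i)` when `A ∩ B ≠ ∅`** — the equality family of the two-cylinder floor (row M2-R49) and,
for `A ∪ B = ι`, of the two-atom floor (row M2-R48). [cite: Harris1960, Lemma 4.1 (p. 16)] -/
theorem cov_andOn_orOn_eq_prod (q : ι → ℝ) (A B : Finset ι) (hAB : (A ∩ B).Nonempty) :
    ex (prodWeight q) ((fun x : ι → Bool => if (∀ i ∈ A, x i = true) then (1 : ℝ) else 0) *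
          fun x => if (∃ i ∈ B, x i = true) then (1 : ℝ) else 0)
      - ex (prodWeight q) (fun x : ι → Bool => if (∀ i ∈ A, x i = true) then (1 : ℝ) else 0)
        * ex (prodWeight q) (fun x => if (∃ i ∈ B, x i = true) then (1 : ℝ) else 0)
      = (∏ i ∈ A, q i) * ∏ i ∈ B, (1 - q i) := by
  obtain ⟨e, he⟩ := hAB
  have heA : e ∈ A := (Finset.mem_inter.1 he).1
  have heB : e ∈ B := (Finset.mem_inter.1 he).2
  -- `AND_A · OR_B = AND_A`
  have hmul : ((fun x : ι → Bool => if (∀ i ∈ A, x i = true) then (1 : ℝ) else 0) *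
        fun x => if (∃ i ∈ B, x i = true) then (1 : ℝ) else 0)
      = fun x : ι → Bool => if (∀ i ∈ A, x i = true) then (1 : ℝ) else 0 := by
    funext x
    simp only [Pi.mul_apply]
    by_cases hx : ∀ i ∈ A, x i = true
    · rw [if_pos hx, if_pos ⟨e, heB, hx e heA⟩, mul_one]
    · rw [if_neg hx, zero_mul]
  -- `OR_B = 1 − NOR_B`
  have hsplit : (fun x : ι → Bool => if (∃ i ∈ B, x i = true) then (1 : ℝ) else 0)
      = fun x => 1 - (if (∀ i ∈ B, x i = false) then (1 : ℝ) else 0) := by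
    funext x
    by_cases hx : ∃ i ∈ B, x i = true
    · obtain ⟨i, hi, hxi⟩ := hx
      rw [if_pos ⟨i, hi, hxi⟩, if_neg (fun h' => by rw [h' i hi] at hxi; exact Bool.false_ne_true hxi)]; ring
    · have hall : ∀ i ∈ B, x i = false := fun i hi => by
        cases h' : x i
        · rfl
        · exact absurd ⟨i, hi, h'⟩ hx
      rw [if_neg hx, if_pos hall]; ring
  have hOR : ex (prodWeight q) (fun x : ι → Bool => if (∃ i ∈ B, x i = true) then (1 : ℝ) else 0) = 1 - ∏ i ∈ B, (1 - q i) := by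
    rw [hsplit]
    have hNOR := ex_norOn_eq_prod q B
    have h1 : ∑ x : ι → Bool, prodWeight q x = 1 := sum_coinWeight q
    unfold ex at hNOR ⊢
    simp only [mul_sub, mul_one, Finset.sum_sub_distrib]
    rw [hNOR, h1]
  rw [hmul, ex_andOn_eq_prod, hOR]
  ring

end QuantHarris

end Summit.CriticalPhenomena.PercolationContinuityZ3.Theorems

end
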